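import Literature.MathematicalPhysics.QuantumFieldTheory.Balaban1983to89.B9Eq3104CommutatorSizes
import Literature.MathematicalPhysics.QuantumFieldTheory.Balaban1983to89.B9Thm37CutoffGradTerms

/-!
# `Balaban1983to89.B9Eq3104CommutatorSupport` — T. Bałaban, *Propagators for lattice gauge theories in a background field*,
# Commun. Math. Phys. **99** (1985) 389–434 [Balaban1985BackgroundPropagators], Sect. C p. 414 l. 1–3 with (3.100)–(3.104) and p. 409 (3.89): THE
# STENCIL OF THE BOND-SECTOR CUT-OFF COMMUTATOR `K(h)(U) = [h, Δ_loc(U)]` — where `(K(h_□)(U)A)(b)` does not vanish, the cut-off `h_□` is NOT CONSTANT on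
# the stencil of `b` (two lattice steps around `b₋`, or the double blocks of the bond averagings through `b`); hence at the cover of record the LEVEL of
# `b` is at most `j + 2` (`□ ∈ 𝒟_j`) and the block of `b` lies within torus block distance `2L + 4` of `supp h_□` (sub-row G-B9-LETTERS, module M5.7-est,
# file E′₂a — the bond-sector twin of this seat's `B9Thm37CommutatorBound389` §1 `levY_le_of_KhY_hTY_ne_zero` ∕ `blkOf_mem_QT_of_KhY_hTY_ne_zero`)

statement-level skeleton of published theorems with citation tags; proofs where landed; nothing here is a claim about the Yang–Mills mass gap

THE PRINT.  p. 414 l. 1–3: «the commutators [D*D, h] and [DD*, h] are first order differential operators with coefficients determined by derivatives of the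
function h»; (3.102): «[Q_j(U), h]A(c) = (S_j(∂h)R_{U,c}A)(c) with an averaging operation S_j having the same properties as Q_j»; (3.103): «(Q*aQhA)(b) =
h(b₋)(Q*aQA)(b) − (S*(∂h)aQA)(b) + (Q*aS(∂h)A)(b)»; p. 409 (3.89): «for x ∈ Δ(y), supp λ ⊂ Δ(y′), y, y′ ∈ □ ∈ 𝒟_j».  Every coefficient of `K(h)` is a
DIFFERENCE of values of `h` at two points of the stencil, so `K(h)A(b) = 0` wherever `h` is constant on the stencil — the content typed here, for the seven
summands of this seat's `B9Eq3104CutoffCommutators.KhBY_eq_sum`.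

## WHAT THIS FILE PROVES (THEOREMS only; 0 definitions, 0 `def … : Prop`, 0 sorry)
* §1 generic vanishing: `trLiftY_apply_eq_zero_of` (a transported lift vanishes at `y` if its argument vanishes on the row support), `cutCommR_trLiftY_apply_eq_zero_of`
  (the cut-off commutator of a transported lift vanishes at `y` if the two profiles agree across the row support), `jordanY_apply_eq_zero_of` (the Jordan insertion is
  fibrewise), `curv2Y_cutMulY_apply_of_const` ∕ `cutCommR_curv2Y_apply_eq_zero_of` (`Δ′₂` commutes with a cut-off constant on the contour bonds through `b`).
* §2 one-step bookkeeping on def-Y's torus chart (p21's `torusSupNorm_sub_self_le_one` reused by name): `touch_symm`, `touch_of_gradK_ne_zero`,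
  `touch_src_of_curlK_ne_zero`, `touch_src_edgeY`, `touch_plaq_of_curlK_ne_zero`.
* §3 ★ `KhBY_apply_eq_zero_of` — `K(h)(U)A(b) = 0` when `h` is constant two lattice steps around `chart b₋` and across the double blocks of the bond averagings
  through `b`; ★ `exists_of_KhBY_ne_zero` (its contrapositive: the stencil alternative).
* §4 at the cut-offs of record `h_□ = hTY i □`: ★★ `levY_src_le_of_KhBY_hTY_ne_zero` — **`(K(h_□)(U)A)(b) ≠ 0 ⟹ lev(b) ≤ j + 2`** (print's «y, y′ ∈ □ ∈ 𝒟_j»; the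
  tree's stencil is two bonds wide and the bond averagings reach one level up, whence `+2`), and ★ `exists_hT_ne_zero_near_of_KhBY_hTY_ne_zero` — OUTPUT
  LOCALISATION: `supp h_□` meets a block within torus block distance `2ℓ + 6` of the block of `b` ([4] (2.45): the double block of a coarse bond spans `≤ ℓ + 3`).
HONEST SCOPE.  Support bookkeeping only (no sizes: those are E′₁ `B9Eq3104CommutatorSizes` and E′₂b); the localisation is stated as a block-distance bound, not as
membership in `QT □` (the bond averagings reach beyond the one-step thickening used on the site sector); nothing of Thm 3.10 ∕ 3.3 asserted; nothing continuum ∕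
OS ∕ mass gap ∕ Clay; YM mass gap NOT proved by any of this (Track A conditional rung).  `--supports stmt-QuantumFields-19200`.  Net new unproved facts: 0.
-/

noncomputable section

namespace Literature.MathematicalPhysics.QuantumFieldTheory.Balaban1983to89.B9Eq3104CommutatorSupport

open Node00
open B9Thm37CubeCoverCommutators (cutMulY cutMulY_apply hTY hTY_apply)
open B9Thm37CubeCoverCommutatorSizes (side_conditions)
open B9Thm37CommutatorBound389 (lev_le_succ_of_touch' torusSupNorm_sub_shiftY_le_one dist_blkOf_le_one_of_touch)
open B9Thm37CutoffGradTerms (torusSupNorm_sub_self_le_one)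
open B9Eq3104CutoffCommutators
open B9Eq3104CutoffCommutatorSizes (gradK_ne_zero_imp src_of_curlK_ne_zero chart_tgt_eq_shiftY)
open B9Eq3104CommutatorSizesCurv (curv2Y_apply primeEdgeY_cutMulY)
open B9Eq3104CommutatorSizesAvg (aY_apply)
open B6KLevelCensusIndexV1 (KIdx)
open B6Ineq2142KLevelV1 (β lvl beta_level qwt lev_ends_bounds)
open B6GlobalChartV1 (PV blkV1)
open B4TorusKernel.MultiPeriod (torusSupNorm)
open B6Geom246MultiLevelBox (bset blkOf blkOf_corner lev_corner)
open B6Geom246MultiLevelTorus (bondT connectedT torusSupNorm_neg)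
open B6MultiLevelTorusOperator (one_le_of_mem)
open B6Cover236MultiLevelBlocks (cubes)
open B6Partition118KLevelTorus (hT)
open B6Partition118KLevelTorusBinders (lev_le_of_near_suppT)
open B6CutoffSupportKLevelV1 (dist_beta_le_of_mem_metBlocks)
open B9Eq3132Ineq2142Covariant (qK_apply ends_of_qwt_ne_zero blkV1_mem_metBlocks two_le_RMh)
open B9GeoLemma21KLevelV1 (one_le_k one_le_Mh one_le_P)
open Node00.OpsYNablaBridge (chartY shiftY_chartY shiftY_symm_chartY divK_apply)
open B9Eq39Adjoint (R R_smul R_zero)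
open scoped Matrix

variable {𝔸 : Type} [NormedRing 𝔸] [NormedAlgebra ℂ 𝔸] [CompleteSpace 𝔸]

/-! ## §1 Generic vanishing of transported lifts and their cut-off commutators -/

section Generic

variable {X Y : Type} [Fintype X] [Fintype Y]

omit [CompleteSpace 𝔸] [Fintype Y] in
/-- a transported lift vanishes at `y` when its argument vanishes on the support of the row `M(y, ·)`.
[cite: Balaban1985BackgroundPropagators, (3.100) p.413, bookkeeping] -/
theorem trLiftY_apply_eq_zero_of (M : Matrix Y X ℝ) (T : Y → X → 𝔸ˣ) (Λ : X → 𝔸) (y : Y) (h : ∀ x, M y x ≠ 0 → Λ x = 0) :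
    trLiftY M T Λ y = 0 := by
  rw [trLiftY_apply]
  refine Finset.sum_eq_zero fun x _ => ?_
  by_cases hM : M y x = 0
  · rw [hM, Complex.ofReal_zero, zero_smul]
  · rw [h x hM, R_zero, smul_zero]

omit [CompleteSpace 𝔸] in
/-- ★ **THE CUT-OFF COMMUTATOR OF A TRANSPORTED LIFT VANISHES WHERE THE PROFILES AGREE ACROSS THE ROW SUPPORT**: if `h_Y(y) = h_X(x)` whenever `M(y,x) ≠ 0`,
then `([h]M♯_T Λ)(y) = 0` («coefficients determined by derivatives of the function h»). [cite: Balaban1985BackgroundPropagators, (3.100) p.413, p.414 l.1–3] -/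
theorem cutCommR_trLiftY_apply_eq_zero_of (hY : Y → ℝ) (hX : X → ℝ) (M : Matrix Y X ℝ) (T : Y → X → 𝔸ˣ) (Λ : X → 𝔸) (y : Y)
    (h : ∀ x, M y x ≠ 0 → hY y = hX x) : cutCommR hY hX (trLiftY M T) Λ y = 0 := by
  rw [cutCommR_trLiftY_apply]
  refine Finset.sum_eq_zero fun x _ => ?_
  by_cases hM : M y x = 0
  · rw [hM, zero_mul, Complex.ofReal_zero, zero_smul]
  · rw [h x hM, sub_self, mul_zero, Complex.ofReal_zero, zero_smul]

end Generic

/-! ## §2 At def-Y's letters: the fibrewise letters, and one-step bookkeeping on the torus chart -/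

section Letters

variable {d ℓ : ℕ} {hd : 1 ≤ d + 1} {hL : Odd (ℓ + 1) ∧ 1 < ℓ + 1} {b₀ b₁ : ℝ}
variable (i : KIdx d ℓ hd hL b₀ b₁)

/-- the Jordan insertion `𝒦_U` is fibrewise: `(𝒦_U F)(p) = 0` when `F(p) = 0`. [cite: Balaban1985BackgroundPropagators, (3.10) p.392, bookkeeping] -/
theorem jordanY_apply_eq_zero_of (U : CfgY 𝔸 i) {F : PlaqY i → 𝔸} {p : PlaqY i} (hF : F p = 0) : jordanY i U F p = 0 := by
  simp only [jordanY, LinearMap.smul_apply, Pi.smul_apply, LinearMap.pi_apply, LinearMap.comp_apply, LinearMap.proj_apply,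
    LinearMap.add_apply, LinearMap.mulRight_apply, LinearMap.mulLeft_apply, hF, zero_mul, mul_zero, add_zero, smul_zero]

omit [CompleteSpace 𝔸] in
/-- the weight letter `a` is diagonal: `(aX)(y) = 0` when `X(y) = 0`. [cite: Balaban1985BackgroundPropagators, (3.25) p.395, bookkeeping] -/
theorem aY_apply_eq_zero_of {Xf : IBondY i → 𝔸} {y : IBondY i} (hX : Xf y = 0) : aY (𝔸 := 𝔸) i Xf y = 0 := by
  rw [aY_apply, hX, smul_zero]

/-- ★ **`Δ′₂(U)` COMMUTES WITH A CUT-OFF THAT IS CONSTANT ON THE CONTOUR BONDS THROUGH `b`**: if `h(b_l(p)₋) = h(b₋)` for every plaquette `p` with `b` on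
its contour and every `l`, then `(Δ′₂(U)(h·A))(b) = h(b₋)•(Δ′₂(U)A)(b)`. [cite: Balaban1985BackgroundPropagators, (3.10) p.392, p.414 («the commutator [Δ′, h]»)] -/
theorem curv2Y_cutMulY_apply_of_const (U : CfgY 𝔸 i) (h : SiteY i → ℝ) (A : FBondY i → 𝔸) (b : FBondY i)
    (hc : ∀ (p : PlaqY i) (m l : Fin 4), edgeY i p m = b → h (chartY i (edgeY i p l).src) = h (chartY i b.src)) :
    curv2Y i U (cutMulY (hBdY i h) A) b = ((h (chartY i b.src) : ℝ) : ℂ) • curv2Y i U A b := by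
  classical
  rw [curv2Y_apply, curv2Y_apply, smul_smul, mul_comm (((h (chartY i b.src) : ℝ) : ℂ)) (1 / 2 : ℂ), ← smul_smul]
  congr 1
  rw [Finset.smul_sum]
  refine Finset.sum_congr rfl fun p _ => ?_
  rw [Finset.smul_sum]
  refine Finset.sum_congr rfl fun m _ => ?_
  split_ifs with hm
  · have hl : ∀ l : Fin 4, primeEdgeY i U p l (cutMulY (hBdY i h) A) = ((h (chartY i b.src) : ℝ) : ℂ) • primeEdgeY i U p l A := by
      intro l
      rw [primeEdgeY_cutMulY, hc p m l hm]
    have hs : ∀ (P : Fin 4 → Prop) [DecidablePred P],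
        ((∑ l : Fin 4, (if P l then primeEdgeY i U p l else 0) : (FBondY i → 𝔸) →ₗ[ℂ] 𝔸) (cutMulY (hBdY i h) A))
          = ((h (chartY i b.src) : ℝ) : ℂ) • ((∑ l : Fin 4, (if P l then primeEdgeY i U p l else 0) : (FBondY i → 𝔸) →ₗ[ℂ] 𝔸) A) := by
      intro P _
      rw [LinearMap.sum_apply, LinearMap.sum_apply, Finset.smul_sum]
      refine Finset.sum_congr rfl fun l _ => ?_
      split_ifs
      · exact hl l
      · rw [LinearMap.zero_apply, LinearMap.zero_apply, smul_zero]
    rw [hs (fun l => m < l), hs (fun l => l < m), ← smul_sub, map_smul, R_smul, smul_comm (sgnY m)]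
  · rw [smul_zero]

/-- hence `([h]Δ′₂(U))A(b) = 0` for such `h`. [cite: Balaban1985BackgroundPropagators, (3.10) p.392, p.414] -/
theorem cutCommR_curv2Y_apply_eq_zero_of (U : CfgY 𝔸 i) (h : SiteY i → ℝ) (A : FBondY i → 𝔸) (b : FBondY i)
    (hc : ∀ (p : PlaqY i) (m l : Fin 4), edgeY i p m = b → h (chartY i (edgeY i p l).src) = h (chartY i b.src)) :
    cutCommR (hBdY i h) (hBdY i h) (curv2Y i U) A b = 0 := by
  rw [cutCommR_apply, curv2Y_cutMulY_apply_of_const i U h A b hc, hBdY_apply, sub_self]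

omit [NormedAlgebra ℂ 𝔸] [CompleteSpace 𝔸] in
/-- `|u − v|_T ≤ 1 ⟹ |v − u|_T ≤ 1`. [cite: Balaban1984PropagatorsII, (2.46) p.231, bookkeeping] -/
theorem touch_symm {u v : SiteY i} (h : torusSupNorm (toKT i).NB (u.1 - v.1) ≤ 1) : torusSupNorm (toKT i).NB (v.1 - u.1) ≤ 1 := by
  rw [show v.1 - u.1 = -(u.1 - v.1) by abel, torusSupNorm_neg (one_le_of_mem u.2)]
  exact h

omit [NormedAlgebra ℂ 𝔸] [CompleteSpace 𝔸] in
/-- the gradient kernel's row support is one lattice step from the bond's initial point: `∂(f, z) ≠ 0 ⟹ |chart f₋ − z|_T ≤ 1`.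
[cite: Balaban1985BackgroundPropagators, (3.3) p.390, bookkeeping] -/
theorem touch_of_gradK_ne_zero {f : FBondY i} {z : SiteY i} (h : gradK i f z ≠ 0) :
    torusSupNorm (toKT i).NB ((chartY i f.src).1 - z.1) ≤ 1 := by
  rcases gradK_ne_zero_imp i h with hz | hz
  · rw [hz]; exact torusSupNorm_sub_self_le_one i _
  · rw [hz, chart_tgt_eq_shiftY]; exact (torusSupNorm_sub_shiftY_le_one i f.dir _).1

omit [NormedAlgebra ℂ 𝔸] [CompleteSpace 𝔸] in
/-- a contour bond of `p` starts one lattice step from `p₋`: `∂(p, f) ≠ 0 ⟹ |chart p₋ − chart f₋|_T ≤ 1`. [cite: Balaban1985BackgroundPropagators, (3.4) p.391, bookkeeping] -/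
theorem touch_src_of_curlK_ne_zero {p : PlaqY i} {f : FBondY i} (h : curlK i p f ≠ 0) :
    torusSupNorm (toKT i).NB ((chartY i p.src).1 - (chartY i f.src).1) ≤ 1 := by
  rcases src_of_curlK_ne_zero i h with hs | hs | hs
  · rw [hs]; exact torusSupNorm_sub_self_le_one i _
  · rw [hs, ← shiftY_chartY]; exact (torusSupNorm_sub_shiftY_le_one i p.μ _).1
  · rw [hs, ← shiftY_chartY]; exact (torusSupNorm_sub_shiftY_le_one i p.ν _).1

omit [NormedAlgebra ℂ 𝔸] [CompleteSpace 𝔸] in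
/-- the four contour bonds of `p` start one lattice step from `p₋`. [cite: Balaban1985BackgroundPropagators, (3.2) p.390, bookkeeping] -/
theorem touch_src_edgeY (p : PlaqY i) (l : Fin 4) : torusSupNorm (toKT i).NB ((chartY i p.src).1 - (chartY i (edgeY i p l).src).1) ≤ 1 := by
  fin_cases l
  · show torusSupNorm (toKT i).NB ((chartY i p.src).1 - (chartY i (p.src.shift p.ν)).1) ≤ 1
    rw [← shiftY_chartY]; exact (torusSupNorm_sub_shiftY_le_one i p.ν _).1
  · exact torusSupNorm_sub_self_le_one i _
  · exact torusSupNorm_sub_self_le_one i _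
  · show torusSupNorm (toKT i).NB ((chartY i p.src).1 - (chartY i (p.src.shift p.μ)).1) ≤ 1
    rw [← shiftY_chartY]; exact (torusSupNorm_sub_shiftY_le_one i p.μ _).1

omit [NormedAlgebra ℂ 𝔸] [CompleteSpace 𝔸] in
/-- a contour bond through `b`: `∂(p, b) ≠ 0 ⟹ |chart b₋ − chart p₋|_T ≤ 1`. [cite: Balaban1985BackgroundPropagators, (3.4) p.391, bookkeeping] -/
theorem touch_plaq_of_curlK_ne_zero {p : PlaqY i} {b : FBondY i} (h : curlK i p b ≠ 0) :
    torusSupNorm (toKT i).NB ((chartY i b.src).1 - (chartY i p.src).1) ≤ 1 :=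
  touch_symm i (touch_src_of_curlK_ne_zero i h)

/-! ## §3 `K(h)(U)A(b) = 0` when `h` is constant on the stencil of `b` -/

/-- ★ **`K(h)(U)A(b)` VANISHES WHEN `h` IS CONSTANT ON THE STENCIL OF `b`**: if `h(u) = h(chart b₋)` for every site `u` two lattice steps around `chart b₋`
(`|chart b₋ − u₁|_T ≤ 1`, `|u₁ − u|_T ≤ 1`), and, for every coarse bond `y` averaging `b` (`Q*(b,y) ≠ 0`), `h` takes the value `h(chart b₋)` at the corner of the
carrier block `β y` and at the initial points of all fine bonds `f` averaged by `y` (`Q(y,f) ≠ 0`), then `(K(h)(U)A)(b) = 0` — each of the seven summands of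
`KhBY_eq_sum` has coefficients `h(·) − h(·)` across exactly these pairs. [cite: Balaban1985BackgroundPropagators, p.414 l.1–3, (3.100)–(3.104) pp.413–414, (3.10) p.392] -/
theorem KhBY_apply_eq_zero_of (h : SiteY i → ℝ) (parB : BondParY 𝔸 i) (U : CfgY 𝔸 i) (A : FBondY i → 𝔸) (b : FBondY i)
    (h1 : ∀ u u₁ : SiteY i, torusSupNorm (toKT i).NB ((chartY i b.src).1 - u₁.1) ≤ 1 → torusSupNorm (toKT i).NB (u₁.1 - u.1) ≤ 1 →
      h u = h (chartY i b.src))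
    (h2 : ∀ y : IBondY i, qsK i b y ≠ 0 → h (blkCornerY i (β i.hN i.D i.hk y)) = h (chartY i b.src) ∧
      ∀ f : FBondY i, qK i y f ≠ 0 → h (chartY i f.src) = h (blkCornerY i (β i.hN i.D i.hk y))) :
    KhBY i h parB U A b = 0 := by
  -- one-step agreements
  have hS : ∀ u : SiteY i, torusSupNorm (toKT i).NB ((chartY i b.src).1 - u.1) ≤ 1 → h u = h (chartY i b.src) :=
    fun u hu => h1 u (chartY i b.src) (torusSupNorm_sub_self_le_one i _) hu
  -- (1) `[h_B | h_P] coCurl`, applied to anything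
  have e1 : cutCommR (hBdY i h) (hPlY i h) (coCurlY i U) (jordanY i U (curlY i U A)) b = 0 := by
    refine cutCommR_trLiftY_apply_eq_zero_of (hBdY i h) (hPlY i h) (cocurlK i) _ _ b fun p hp => ?_
    have hp' : curlK i p b ≠ 0 := by rwa [cocurlK_eq_transpose, Matrix.transpose_apply] at hp
    exact (hS _ (touch_plaq_of_curlK_ne_zero i hp')).symm
  -- (2) `coCurl ∘ 𝒦 ∘ [h_P | h_B] curl`
  have e2 : coCurlY i U (jordanY i U (cutCommR (hPlY i h) (hBdY i h) (curlY i U) A)) b = 0 := by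
    refine trLiftY_apply_eq_zero_of (cocurlK i) _ _ b fun p hp => jordanY_apply_eq_zero_of i U ?_
    have hp' : curlK i p b ≠ 0 := by rwa [cocurlK_eq_transpose, Matrix.transpose_apply] at hp
    refine cutCommR_trLiftY_apply_eq_zero_of (hPlY i h) (hBdY i h) (curlK i) _ A p fun f hf => ?_
    show h (chartY i p.src) = h (chartY i f.src)
    rw [hS _ (touch_plaq_of_curlK_ne_zero i hp'), h1 (chartY i f.src) (chartY i p.src) (touch_plaq_of_curlK_ne_zero i hp')
      (touch_src_of_curlK_ne_zero i hf)]
  -- (3) `[h_B] Δ′₂`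
  have e3 : cutCommR (hBdY i h) (hBdY i h) (curv2Y i U) A b = 0 := by
    refine cutCommR_curv2Y_apply_eq_zero_of i U h A b fun p m l hm => ?_
    have t₁ : torusSupNorm (toKT i).NB ((chartY i b.src).1 - (chartY i p.src).1) ≤ 1 := by
      rw [← hm]; exact touch_symm i (touch_src_edgeY i p m)
    exact h1 _ (chartY i p.src) t₁ (touch_src_edgeY i p l)
  -- (4) `[h_B | h] D`, applied to `D* A`
  have e4 : cutCommR (hBdY i h) h (gradY i U) (divY i U A) b = 0 := by
    refine cutCommR_trLiftY_apply_eq_zero_of (hBdY i h) h (gradK i) _ _ b fun z hz => ?_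
    exact (hS z (touch_of_gradK_ne_zero i hz)).symm
  -- (5) `D ∘ [h | h_B] D*`
  have e5 : gradY i U (cutCommR h (hBdY i h) (divY i U) A) b = 0 := by
    refine trLiftY_apply_eq_zero_of (gradK i) _ _ b fun z hz => ?_
    refine cutCommR_trLiftY_apply_eq_zero_of h (hBdY i h) (divK i) _ A z fun f hf => ?_
    rw [divK_apply] at hf
    show h z = h (chartY i f.src)
    rw [hS z (touch_of_gradK_ne_zero i hz), h1 (chartY i f.src) z (touch_of_gradK_ne_zero i hz) (touch_symm i (touch_of_gradK_ne_zero i hf))]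
  -- (6) `[h_B | h_I] Q*`, applied to `a Q A`
  have e6 : cutCommR (hBdY i h) (hIbY i h) (QsY i parB U) (aY i (QY i parB U A)) b = 0 := by
    refine cutCommR_trLiftY_apply_eq_zero_of (hBdY i h) (hIbY i h) (qsK i) _ _ b fun y hy => ?_
    exact ((h2 y hy).1).symm
  -- (7) `Q* ∘ a ∘ [h_I | h_B] Q`
  have e7 : QsY i parB U (aY i (cutCommR (hIbY i h) (hBdY i h) (QY i parB U) A)) b = 0 := by
    refine trLiftY_apply_eq_zero_of (qsK i) _ _ b fun y hy => aY_apply_eq_zero_of i ?_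
    refine cutCommR_trLiftY_apply_eq_zero_of (hIbY i h) (hBdY i h) (qK i) _ A y fun f hf => ?_
    exact ((h2 y hy).2 f hf).symm
  rw [KhBY_eq_sum]
  simp only [LinearMap.add_apply, Pi.add_apply, LinearMap.comp_apply]
  rw [e1, e2, e3, e4, e5, e6, e7]
  simp

/-- ★ **THE STENCIL ALTERNATIVE** (contrapositive of `KhBY_apply_eq_zero_of`): where `(K(h)(U)A)(b) ≠ 0`, either `h` takes two different values two lattice
steps around `chart b₋`, or it varies across the double block of a bond averaging through `b`. [cite: Balaban1985BackgroundPropagators, p.414 l.1–3, (3.102)–(3.103) p.414] -/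
theorem exists_of_KhBY_ne_zero (h : SiteY i → ℝ) (parB : BondParY 𝔸 i) (U : CfgY 𝔸 i) (A : FBondY i → 𝔸) (b : FBondY i)
    (hK : KhBY i h parB U A b ≠ 0) :
    (∃ u u₁ : SiteY i, torusSupNorm (toKT i).NB ((chartY i b.src).1 - u₁.1) ≤ 1 ∧ torusSupNorm (toKT i).NB (u₁.1 - u.1) ≤ 1 ∧
        h u ≠ h (chartY i b.src))
      ∨ ∃ y : IBondY i, qsK i b y ≠ 0 ∧ (h (blkCornerY i (β i.hN i.D i.hk y)) ≠ h (chartY i b.src)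
          ∨ ∃ f : FBondY i, qK i y f ≠ 0 ∧ h (chartY i f.src) ≠ h (blkCornerY i (β i.hN i.D i.hk y))) := by
  by_contra hc
  push Not at hc
  obtain ⟨hc1, hc2⟩ := hc
  exact hK (KhBY_apply_eq_zero_of i h parB U A b (fun u u₁ h01 h1u => hc1 u u₁ h01 h1u) fun y hy => hc2 y hy)

/-! ## §4 At the cut-offs of record: the level window and the output localisation -/

/-- the torus level of the corner of a carrier block `β y` is the level `j(y)` of the coarse bond (p33's `B9B8AveragingJunction.levY_blkCornerY` for a
general block; here through r03's `lev_corner`). [cite: Balaban1984PropagatorsII, (2.45) p.231, bookkeeping] -/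
theorem levY_blkCornerY_beta (y : IBondY i) : levY i (blkCornerY i (β i.hN i.D i.hk y)) = lvl i.hN i.D i.hk y := by
  have h : levY i (blkCornerY i (β i.hN i.D i.hk y)) = (β i.hN i.D i.hk y).1.1 := lev_corner i.D.toDomains _
  rw [h, beta_level i.hN i.D i.hk (one_le_k i)]

/-- `Q*(b, y) ≠ 0` is `q_y(b) ≠ 0` (r03's weight). [cite: Balaban1984PropagatorsI, (1.18) p.20, bookkeeping] -/
theorem qwt_ne_zero_of_qsK_ne_zero {b : FBondY i} {y : IBondY i} (h : qsK i b y ≠ 0) : qwt i.hN i.D i.hk y b ≠ 0 := by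
  rwa [qsK_eq_transpose, Matrix.transpose_apply, qK_apply] at h

/-- `Q(y, f) ≠ 0` is `q_y(f) ≠ 0`. [cite: Balaban1984PropagatorsI, (1.18) p.20, bookkeeping] -/
theorem qwt_ne_zero_of_qK_ne_zero {y : IBondY i} {f : FBondY i} (h : qK i y f ≠ 0) : qwt i.hN i.D i.hk y f ≠ 0 := by
  rwa [qK_apply] at h

/-- **a fine bond averaged by `y` has level `j(y)` or `j(y) − 1`** ([4] (2.2)–(2.4): both ends of the double block).
[cite: Balaban1984PropagatorsII, (2.2)–(2.4) p.224; Balaban1984PropagatorsI, (1.18) p.20] -/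
theorem levY_src_bounds_of_qwt_ne_zero {y : IBondY i} {f : FBondY i} (h : qwt i.hN i.D i.hk y f ≠ 0) :
    lvl i.hN i.D i.hk y - 1 ≤ levY i (chartY i f.src) ∧ levY i (chartY i f.src) ≤ lvl i.hN i.D i.hk y :=
  lev_ends_bounds i.hN i.D i.hk (one_le_k i) (two_le_RMh i) y (ends_of_qwt_ne_zero i h)

/-- ★★ **THE LEVEL WINDOW OF THE BOND-SECTOR (3.89) TERMS: `(K(h_□)(U)A)(b) ≠ 0 ⟹ lev(b) ≤ j + 2`** for a cube `□` of level `j` of the cover of record —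
print's «y, y′ ∈ □ ∈ 𝒟_j» (the stencil is two bonds wide: `+2`; across a bond averaging the fine bonds of `supp h_□` have level `≤ j + 1` and the coarse bond
one more). [cite: Balaban1985BackgroundPropagators, (3.89) p.409 («y, y′ ∈ □ ∈ 𝒟_j»), p.414 l.1–3; Balaban1984PropagatorsII, (2.2)–(2.4) p.224] -/
theorem levY_src_le_of_KhBY_hTY_ne_zero (c : ↥(cubes i.D.toDomains)) (parB : BondParY 𝔸 i) (U : CfgY 𝔸 i) (A : FBondY i → 𝔸) (b : FBondY i)
    (hK : KhBY i (hTY i c) parB U A b ≠ 0) : levY i (chartY i b.src) ≤ c.1.1 + 2 := by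
  obtain ⟨hℓ, hMh, hR, hP5⟩ := side_conditions i
  have near : ∀ {z z' : SiteY i}, hTY i c z' ≠ 0 → torusSupNorm (toKT i).NB (z.1 - z'.1) ≤ 1 → levY i z ≤ c.1.1 + 1 :=
    fun {z z'} hz' hzz' => lev_le_of_near_suppT (D := i.D) hℓ hMh hR hP5 c hz' hzz'
  rcases exists_of_KhBY_ne_zero i _ parB U A b hK with ⟨u, u₁, h01, h1u, hne⟩ | ⟨y, hy, hrest⟩
  · by_cases h0 : hTY i c (chartY i b.src) = 0
    · rw [h0] at hne
      have h1 : levY i u₁ ≤ c.1.1 + 1 := near hne h1u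
      have h2 : levY i (chartY i b.src) ≤ levY i u₁ + 1 := lev_le_succ_of_touch' i h01
      omega
    · exact (near h0 (torusSupNorm_sub_self_le_one i _)).trans (by omega)
  · have hq : qwt i.hN i.D i.hk y b ≠ 0 := qwt_ne_zero_of_qsK_ne_zero i hy
    have hlevb : levY i (chartY i b.src) ≤ lvl i.hN i.D i.hk y := (levY_src_bounds_of_qwt_ne_zero i hq).2
    have hcorner : hTY i c (blkCornerY i (β i.hN i.D i.hk y)) ≠ 0 → lvl i.hN i.D i.hk y ≤ c.1.1 + 1 := fun hc0 => by
      have e := near hc0 (torusSupNorm_sub_self_le_one i _)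
      rwa [levY_blkCornerY_beta] at e
    rcases hrest with hne | ⟨f, hf, hne⟩
    · by_cases h0 : hTY i c (chartY i b.src) = 0
      · rw [h0] at hne
        exact hlevb.trans ((hcorner hne).trans (by omega))
      · exact (near h0 (torusSupNorm_sub_self_le_one i _)).trans (by omega)
    · by_cases h0 : hTY i c (blkCornerY i (β i.hN i.D i.hk y)) = 0
      · rw [h0] at hne
        have h1 : levY i (chartY i f.src) ≤ c.1.1 + 1 := near hne (torusSupNorm_sub_self_le_one i _)
        have h2 := (levY_src_bounds_of_qwt_ne_zero i (qwt_ne_zero_of_qK_ne_zero i hf)).1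
        omega
      · exact hlevb.trans ((hcorner h0).trans (by omega))

/-- the torus block distance of the blocks of two adjacent sites is `≤ 1`, at `i.D`. [cite: Balaban1984PropagatorsII, (2.46) p.231, bookkeeping] -/
theorem dist_blkOf_le_one_of_touch' {x x' : SiteY i} (h : torusSupNorm (toKT i).NB (x.1 - x'.1) ≤ 1) :
    ((bondT i.D).dist (blkOf i.D.toDomains x) (blkOf i.D.toDomains x') : ℝ) ≤ 1 := by
  exact_mod_cast dist_blkOf_le_one_of_touch i h

/-- the triangle inequality of the torus block distance, in `ℝ`. [cite: Balaban1984PropagatorsII, (2.46) p.231, bookkeeping] -/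
theorem dist_bondT_triangle (s t u : BlkY i) :
    ((bondT i.D).dist s u : ℝ) ≤ ((bondT i.D).dist s t : ℝ) + ((bondT i.D).dist t u : ℝ) := by
  exact_mod_cast (connectedT (D := i.D) (one_le_Mh i) (one_le_P i)).dist_triangle (u := s) (v := t) (w := u)

/-- the double block of a coarse bond averaging `f` lies within `ℓ + 3` of the block of `f`. [cite: Balaban1984PropagatorsII, (2.45) p.231] -/
theorem dist_blkV1_beta_le_of_qwt_ne_zero {y : IBondY i} {f : FBondY i} (h : qwt i.hN i.D i.hk y f ≠ 0) :
    ((bondT i.D).dist (blkV1 i.hN i.D f) (β i.hN i.D i.hk y) : ℝ) ≤ (ℓ : ℝ) + 3 := by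
  have e := dist_beta_le_of_mem_metBlocks i.hN i.D i.hk (one_le_k i) (two_le_RMh i) (one_le_Mh i) (one_le_P i) y (blkV1_mem_metBlocks i h)
  rw [SimpleGraph.dist_comm]
  exact e

/-- ★ **OUTPUT LOCALISATION OF THE BOND-SECTOR (3.89) TERMS**: where `(K(h_□)(U)A)(b) ≠ 0`, the support of `h_□` meets a block within torus block distance
`2ℓ + 6` of the block of `b` (two lattice steps: `≤ 2`; a bond averaging through `b`: carrier block `≤ ℓ + 3`, its fine bonds `≤ 2ℓ + 6`).
[cite: Balaban1985BackgroundPropagators, (3.89) p.409 («x ∈ Δ(y), … y, y′ ∈ □»), (3.91) p.410; Balaban1984PropagatorsII, (2.45) p.231] -/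
theorem exists_hT_ne_zero_near_of_KhBY_hTY_ne_zero (c : ↥(cubes i.D.toDomains)) (parB : BondParY 𝔸 i) (U : CfgY 𝔸 i) (A : FBondY i → 𝔸)
    (b : FBondY i) (hK : KhBY i (hTY i c) parB U A b ≠ 0) :
    ∃ u : SiteY i, hT i.D c u ≠ 0 ∧ ((bondT i.D).dist (blkV1 i.hN i.D b) (blkOf i.D.toDomains u) : ℝ) ≤ 2 * (ℓ : ℝ) + 6 := by
  have hℓ0 : (0 : ℝ) ≤ (ℓ : ℝ) := Nat.cast_nonneg ℓ
  have self : ∀ u : SiteY i, ((bondT i.D).dist (blkOf i.D.toDomains u) (blkOf i.D.toDomains u) : ℝ) ≤ 2 * (ℓ : ℝ) + 6 := fun u => by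
    rw [SimpleGraph.dist_self, Nat.cast_zero]; linarith
  rcases exists_of_KhBY_ne_zero i _ parB U A b hK with ⟨u, u₁, h01, h1u, hne⟩ | ⟨y, hy, hrest⟩
  · by_cases h0 : hTY i c (chartY i b.src) = 0
    · rw [h0] at hne
      refine ⟨u, hne, ?_⟩
      have d1 := dist_blkOf_le_one_of_touch' i h01
      have d2 := dist_blkOf_le_one_of_touch' i h1u
      have t := dist_bondT_triangle i (blkOf i.D.toDomains (chartY i b.src)) (blkOf i.D.toDomains u₁) (blkOf i.D.toDomains u)
      change ((bondT i.D).dist (blkOf i.D.toDomains (chartY i b.src)) (blkOf i.D.toDomains u) : ℝ) ≤ _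
      linarith
    · exact ⟨chartY i b.src, h0, self _⟩
  · have hq : qwt i.hN i.D i.hk y b ≠ 0 := qwt_ne_zero_of_qsK_ne_zero i hy
    have db : ((bondT i.D).dist (blkV1 i.hN i.D b) (β i.hN i.D i.hk y) : ℝ) ≤ (ℓ : ℝ) + 3 := dist_blkV1_beta_le_of_qwt_ne_zero i hq
    rcases hrest with hne | ⟨f, hf, hne⟩
    · by_cases h0 : hTY i c (chartY i b.src) = 0
      · rw [h0] at hne
        refine ⟨blkCornerY i (β i.hN i.D i.hk y), hne, ?_⟩
        rw [show blkOf i.D.toDomains (blkCornerY i (β i.hN i.D i.hk y)) = β i.hN i.D i.hk y from blkOf_corner i.D.toDomains _]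
        linarith
      · exact ⟨chartY i b.src, h0, self _⟩
    · by_cases h0 : hTY i c (blkCornerY i (β i.hN i.D i.hk y)) = 0
      · rw [h0] at hne
        refine ⟨chartY i f.src, hne, ?_⟩
        have df : ((bondT i.D).dist (blkV1 i.hN i.D f) (β i.hN i.D i.hk y) : ℝ) ≤ (ℓ : ℝ) + 3 :=
          dist_blkV1_beta_le_of_qwt_ne_zero i (qwt_ne_zero_of_qK_ne_zero i hf)
        have t := dist_bondT_triangle i (blkV1 i.hN i.D b) (β i.hN i.D i.hk y) (blkV1 i.hN i.D f)
        rw [SimpleGraph.dist_comm (u := β i.hN i.D i.hk y) (v := blkV1 i.hN i.D f)] at t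
        change ((bondT i.D).dist (blkV1 i.hN i.D b) (blkV1 i.hN i.D f) : ℝ) ≤ _
        linarith
      · refine ⟨blkCornerY i (β i.hN i.D i.hk y), h0, ?_⟩
        rw [show blkOf i.D.toDomains (blkCornerY i (β i.hN i.D i.hk y)) = β i.hN i.D i.hk y from blkOf_corner i.D.toDomains _]
        linarith

end Letters

end Literature.MathematicalPhysics.QuantumFieldTheory.Balaban1983to89.B9Eq3104CommutatorSupport

end
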